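import Mathlib
import Summits.NavierStokesRegularity.NavierStokesRegularity.Theorems.EulerZoomLiouvillePowerGaugeEulerLiouvilleCasimirHaulSlicingBochner
import Summits.NavierStokesRegularity.NavierStokesRegularity.Theorems.EulerZoomLiouvillePowerGaugeEulerLiouvilleCasimirHaulSliceEstimate
import Summits.NavierStokesRegularity.NavierStokesRegularity.Theorems.EulerZoomLiouvillePowerGaugeEulerLiouvilleCasimirHaulLogMoment
import Literature.Analysis.FunctionSpaces.PlanarBathtub
import HarnessLib

/-!
# Crux `EulerZoomLiouville.PowerGaugeEulerLiouville` (stmt-NavierStokesRegularity-19832), sub-line `casimir_haul`: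
# H3 `stub_haulingInequality` — slice bookkeeping in the solid cylinder and the per-slice estimate

Route №10 `EulerZoomLiouville` (NavierStokesRegularity), crux E = stmt-NavierStokesRegularity-19832; width seat ns-ezl-w2 g7 under the LEAD ns-typeII-p2.
Assembly lemmas for the hauling inequality (`…CasimirHaulHaulingInequality.haulingInequality`) over the bricks
`…CasimirHaulSlicing(Bochner)`, `…CasimirHaulSliceEstimate`, `…CasimirHaulLogMoment`, `Literature…PlanarBathtub`:

* `lintegral_solidCyl_eq_slices` — `∫⁻_{r<2b, |x₂|<b} g = ∫⁻_{t∈(−b,b)} ∫⁻_{|y|<2b} g(y₀,y₁,t)`;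
* `lintegral_sq_volume_sliceSet_le` — `∫⁻_t |A_t|² ≤ 2π ∫⁻_A r²` (planar bathtub slice by slice + Fubini);
* `norm_fderiv_slice_component_le` — `‖D_y (v(y₀,y₁,t))₂‖ ≤ ‖Dv(y₀,y₁,t)‖`;
* `setIntegral_w_mul_eq_integral_slices` — `∫_A w(x₂) v₂ = ∫_t w(t) ∫_{A_t} (v(·,t))₂`; `moment_slices` — `∫_t ∫_{A_t}|y|² = ∫_A r²`;
* `enorm_setIntegral_slice_le` — the planar small-set estimate (H2) in one slice, in `ℝ≥0∞` currency.
[folklore]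

WHAT THIS IS NOT: not NS, not E, not H3 itself — bookkeeping `--supports` stmt-19832; 19832 is an OPEN crux class.
-/

noncomputable section

-- flat `Theorems/<Route><Decl>…` files of one crux share the namespace of the crux (tree convention)
set_option linter.dupNamespace false

open MeasureTheory Set Filter Function WithLp Metric Real
open scoped ENNReal Topology

namespace Summit.NavierStokesRegularity.NavierStokesRegularity.Theorems.PowerGaugeEulerLiouville.CasimirHaul

open Literature.Analysis.FluidPDE Literature.Analysis.FunctionSpaces

section Slices

/-- **Fubini over the solid cylinder** `{r < 2b, |x₂| < b}`: `∫⁻_{cyl} g = ∫⁻_{t ∈ (−b,b)} ∫⁻_{y ∈ B(0,2b)} g(y₀, y₁, t)`. [folklore] -/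
theorem lintegral_solidCyl_eq_slices {b : ℝ} {g : EuclideanSpace ℝ (Fin 3) → ℝ≥0∞} (hg : Measurable g) :
    ∫⁻ x in {x : EuclideanSpace ℝ (Fin 3) | cylRadius x < 2 * b ∧ |x 2| < b}, g x =
      ∫⁻ t in Ioo (-b) b, ∫⁻ y in ball (0 : EuclideanSpace ℝ (Fin 2)) (2 * b), g (toLp 2 ![y 0, y 1, t]) := by
  have hcyl : MeasurableSet {x : EuclideanSpace ℝ (Fin 3) | cylRadius x < 2 * b ∧ |x 2| < b} := by
    have h1 : MeasurableSet {x : EuclideanSpace ℝ (Fin 3) | cylRadius x < 2 * b} :=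
      measurableSet_lt continuous_cylRadius.measurable measurable_const
    have h2 : MeasurableSet {x : EuclideanSpace ℝ (Fin 3) | |x 2| < b} :=
      measurableSet_lt (continuous_abs.comp (PiLp.continuous_apply 2 (fun _ : Fin 3 => ℝ) 2)).measurable measurable_const
    exact h1.inter h2
  -- pointwise splitting of the cylinder's indicator at a slice point
  have hpt : ∀ (t : ℝ) (y : EuclideanSpace ℝ (Fin 2)),
      ({x : EuclideanSpace ℝ (Fin 3) | cylRadius x < 2 * b ∧ |x 2| < b}.indicator g) (toLp 2 ![y 0, y 1, t]) =
        (Ioo (-b) b).indicator (fun t => (ball (0 : EuclideanSpace ℝ (Fin 2)) (2 * b)).indicator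
          (fun y => g (toLp 2 ![y 0, y 1, t])) y) t := by
    intro t y
    have ht2 : (toLp 2 ![y 0, y 1, t] : EuclideanSpace ℝ (Fin 3)) 2 = t := by simp
    by_cases ht : t ∈ Ioo (-b) b
    · rw [indicator_of_mem ht]
      by_cases hy : y ∈ ball (0 : EuclideanSpace ℝ (Fin 2)) (2 * b)
      · have hmem : (toLp 2 ![y 0, y 1, t] : EuclideanSpace ℝ (Fin 3)) ∈
            {x : EuclideanSpace ℝ (Fin 3) | cylRadius x < 2 * b ∧ |x 2| < b} := by
          refine ⟨?_, ?_⟩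
          · rw [cylRadius_sliceMap]; exact mem_ball_zero_iff.1 hy
          · rw [ht2]; exact abs_lt.2 ⟨by linarith [ht.1], ht.2⟩
        rw [indicator_of_mem hy, indicator_of_mem hmem]
      · have hnm : (toLp 2 ![y 0, y 1, t] : EuclideanSpace ℝ (Fin 3)) ∉
            {x : EuclideanSpace ℝ (Fin 3) | cylRadius x < 2 * b ∧ |x 2| < b} := fun h =>
          hy (mem_ball_zero_iff.2 (by rw [← cylRadius_sliceMap y t]; exact h.1))
        rw [indicator_of_notMem hy, indicator_of_notMem hnm]
    · have hnm : (toLp 2 ![y 0, y 1, t] : EuclideanSpace ℝ (Fin 3)) ∉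
          {x : EuclideanSpace ℝ (Fin 3) | cylRadius x < 2 * b ∧ |x 2| < b} := fun h => by
        have h2 := h.2
        rw [ht2] at h2
        exact ht ⟨by linarith [(abs_lt.1 h2).1], (abs_lt.1 h2).2⟩
      rw [indicator_of_notMem ht, indicator_of_notMem hnm]
  rw [← lintegral_indicator hcyl, lintegral_eq_lintegral_slices (hg.indicator hcyl), ← lintegral_indicator measurableSet_Ioo]
  refine lintegral_congr fun t => ?_
  simp_rw [hpt]
  by_cases ht : t ∈ Ioo (-b) b
  · simp only [indicator_of_mem ht]
    rw [lintegral_indicator measurableSet_ball]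
  · simp only [indicator_of_notMem ht, lintegral_zero]

/-- **`∫⁻_t |A_t|² ≤ 2π ∫⁻_A r²`** (planar bathtub in every slice, Fubini along the axis). [folklore] -/
theorem lintegral_sq_volume_sliceSet_le {A : Set (EuclideanSpace ℝ (Fin 3))} (hA : MeasurableSet A) {R : ℝ}
    (hAR : ∀ x ∈ A, cylRadius x < R) :
    ∫⁻ t : ℝ, volume {y : EuclideanSpace ℝ (Fin 2) | (toLp 2 ![y 0, y 1, t] : EuclideanSpace ℝ (Fin 3)) ∈ A} ^ 2 ≤
      ENNReal.ofReal (2 * π) * ∫⁻ x in A, ENNReal.ofReal (cylRadius x ^ 2) := by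
  -- Fubini for `1_A · r²`
  have hg : Measurable (A.indicator fun x : EuclideanSpace ℝ (Fin 3) => ENNReal.ofReal (cylRadius x ^ 2)) :=
    (continuous_cylRadius.pow 2).measurable.ennreal_ofReal.indicator hA
  rw [← lintegral_indicator hA, lintegral_eq_lintegral_slices hg, ← lintegral_const_mul' _ _ ENNReal.ofReal_ne_top]
  refine lintegral_mono fun t => ?_
  -- in the slice: bathtub
  have hAt : MeasurableSet {y : EuclideanSpace ℝ (Fin 2) | (toLp 2 ![y 0, y 1, t] : EuclideanSpace ℝ (Fin 3)) ∈ A} :=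
    measurableSet_sliceSet hA t
  have hAtB := sliceSet_subset_ball hAR t
  have hfin : volume {y : EuclideanSpace ℝ (Fin 2) | (toLp 2 ![y 0, y 1, t] : EuclideanSpace ℝ (Fin 3)) ∈ A} ≠ ⊤ :=
    ((measure_mono hAtB).trans_lt measure_ball_lt_top).ne
  have h := sq_volume_le_lintegral_norm_sq hAt hfin (0 : EuclideanSpace ℝ (Fin 2))
  refine h.trans (le_of_eq ?_)
  congr 1
  rw [← lintegral_indicator hAt]
  refine lintegral_congr fun y => ?_
  by_cases hy : (toLp 2 ![y 0, y 1, t] : EuclideanSpace ℝ (Fin 3)) ∈ A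
  · rw [indicator_of_mem (show y ∈ {y : EuclideanSpace ℝ (Fin 2) |
        (toLp 2 ![y 0, y 1, t] : EuclideanSpace ℝ (Fin 3)) ∈ A} from hy), indicator_of_mem hy, sub_zero,
      cylRadius_sliceMap]
  · rw [indicator_of_notMem (show y ∉ {y : EuclideanSpace ℝ (Fin 2) |
        (toLp 2 ![y 0, y 1, t] : EuclideanSpace ℝ (Fin 3)) ∈ A} from hy), indicator_of_notMem hy]

/-- **`‖D_y (v(y₀,y₁,t))₂‖ ≤ ‖Dv(y₀,y₁,t)‖`** for `v` differentiable (the slice map is an isometric embedding and the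
coordinate projection has norm `≤ 1`). [folklore] -/
theorem norm_fderiv_slice_component_le {v : EuclideanSpace ℝ (Fin 3) → EuclideanSpace ℝ (Fin 3)} (t : ℝ)
    (y : EuclideanSpace ℝ (Fin 2)) (hv : DifferentiableAt ℝ v (toLp 2 ![y 0, y 1, t])) :
    ‖fderiv ℝ (fun y : EuclideanSpace ℝ (Fin 2) => (v (toLp 2 ![y 0, y 1, t])) 2) y‖ ≤ ‖fderiv ℝ v (toLp 2 ![y 0, y 1, t])‖ := by
  obtain ⟨hdiff, hle⟩ := norm_fderiv_comp_sliceMap_le (v := v) t y hv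
  -- the coordinate projection as a continuous linear map of norm ≤ 1
  have hproj : fderiv ℝ (fun y : EuclideanSpace ℝ (Fin 2) => (v (toLp 2 ![y 0, y 1, t])) 2) y =
      (EuclideanSpace.proj (2 : Fin 3)).comp (fderiv ℝ (fun y : EuclideanSpace ℝ (Fin 2) => v (toLp 2 ![y 0, y 1, t])) y) := by
    rw [show (fun y : EuclideanSpace ℝ (Fin 2) => (v (toLp 2 ![y 0, y 1, t])) 2) =
      (EuclideanSpace.proj (2 : Fin 3)) ∘ (fun y : EuclideanSpace ℝ (Fin 2) => v (toLp 2 ![y 0, y 1, t])) from rfl]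
    rw [fderiv_comp y (EuclideanSpace.proj (2 : Fin 3)).differentiableAt hdiff, ContinuousLinearMap.fderiv]
  rw [hproj]
  calc ‖(EuclideanSpace.proj (2 : Fin 3)).comp (fderiv ℝ (fun y : EuclideanSpace ℝ (Fin 2) => v (toLp 2 ![y 0, y 1, t])) y)‖
      ≤ ‖(EuclideanSpace.proj (2 : Fin 3) : EuclideanSpace ℝ (Fin 3) →L[ℝ] ℝ)‖ *
          ‖fderiv ℝ (fun y : EuclideanSpace ℝ (Fin 2) => v (toLp 2 ![y 0, y 1, t])) y‖ :=
        ContinuousLinearMap.opNorm_comp_le _ _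
    _ ≤ 1 * ‖fderiv ℝ v (toLp 2 ![y 0, y 1, t])‖ := by
        gcongr
        refine ContinuousLinearMap.opNorm_le_bound _ zero_le_one fun x => ?_
        rw [one_mul]
        exact PiLp.norm_apply_le x 2
    _ = _ := one_mul _

end Slices

section Tools

/-- `ofReal ∫ f ≤ ∫⁻ ofReal f` for a pointwise nonnegative `f` (no integrability needed; file-local form). [folklore] -/
private theorem ofReal_integral_le_lintegral_ofReal_aux {α : Type*} [MeasurableSpace α] {μ : Measure α}
    {f : α → ℝ} (hf : ∀ x, 0 ≤ f x) :
    ENNReal.ofReal (∫ x, f x ∂μ) ≤ ∫⁻ x, ENNReal.ofReal (f x) ∂μ := by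
  by_cases hfi : Integrable f μ
  · rw [ofReal_integral_eq_lintegral_ofReal hfi (ae_of_all _ hf)]
  · rw [integral_undef hfi, ENNReal.ofReal_zero]
    exact zero_le

/-- `ENNReal.ofReal (√x) = (ENNReal.ofReal x) ^ (1/2)` [folklore] -/
theorem ofReal_sqrt_eq_rpow_half {x : ℝ} (hx : 0 ≤ x) :
    ENNReal.ofReal (Real.sqrt x) = ENNReal.ofReal x ^ (1 / 2 : ℝ) := by
  rw [Real.sqrt_eq_rpow, ENNReal.ofReal_rpow_of_nonneg hx (by norm_num)]

/-- The solid cylinder `{r < 2b, |x₂| < b}` lies in the closed ball `B̄(0, 3b)`. [folklore] -/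
theorem solidCyl_subset_closedBall (b : ℝ) :
    {x : (EuclideanSpace ℝ (Fin 3)) | cylRadius x < 2 * b ∧ |x 2| < b} ⊆ closedBall (0 : (EuclideanSpace ℝ (Fin 3))) (3 * b) := by
  intro x hx
  have h1 : cylRadius x < 2 * b := hx.1
  have h2 : |x 2| < b := hx.2
  have hr0 : 0 ≤ cylRadius x := cylRadius_nonneg x
  have hb : 0 < b := lt_of_le_of_lt (abs_nonneg _) h2
  have hn : ‖x‖ ^ 2 = cylRadius x ^ 2 + x 2 ^ 2 := by
    rw [EuclideanSpace.norm_eq, Real.sq_sqrt (Finset.sum_nonneg fun i _ => sq_nonneg _), Fin.sum_univ_three,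
      cylRadius_sq]
    simp only [Real.norm_eq_abs, sq_abs]
  have hx2 : x 2 ^ 2 < b ^ 2 := by
    have := abs_lt.1 h2
    nlinarith [this.1, this.2]
  have hr2 : cylRadius x ^ 2 < (2 * b) ^ 2 := by nlinarith
  rw [mem_closedBall_zero_iff]
  nlinarith [norm_nonneg x, hn]

/-- A continuous function is integrable on any subset of the solid cylinder. [folklore] -/
theorem integrableOn_of_subset_solidCyl {F : Type*} [NormedAddCommGroup F] {g : (EuclideanSpace ℝ (Fin 3)) → F} (hg : Continuous g)
    {b : ℝ} {A : Set (EuclideanSpace ℝ (Fin 3))} (hA : A ⊆ {x : (EuclideanSpace ℝ (Fin 3)) | cylRadius x < 2 * b ∧ |x 2| < b}) : IntegrableOn g A volume :=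
  ((hg.continuousOn.integrableOn_compact (isCompact_closedBall (0 : (EuclideanSpace ℝ (Fin 3))) (3 * b))).mono_set
    ((hA.trans (solidCyl_subset_closedBall b))))

/-- Measurability in the axial variable of ball-slice integrals: for measurable `g ≥ 0`,
`t ↦ ∫⁻_{y ∈ B(0,R)} g(y₀, y₁, t)` is measurable. [folklore] -/
theorem measurable_lintegral_ball_slice {g : (EuclideanSpace ℝ (Fin 3)) → ℝ≥0∞} (hg : Measurable g) (R : ℝ) :
    Measurable fun t : ℝ => ∫⁻ y in ball (0 : (EuclideanSpace ℝ (Fin 2))) R, g (toLp 2 ![y 0, y 1, t]) := by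
  have h1 : Measurable fun p : ℝ × (EuclideanSpace ℝ (Fin 2)) => g (toLp 2 ![p.2 0, p.2 1, p.1]) :=
    hg.comp (measurable_sliceMap.comp measurable_swap)
  have h2 : Measurable ((Prod.snd ⁻¹' ball (0 : (EuclideanSpace ℝ (Fin 2))) R).indicator fun p : ℝ × (EuclideanSpace ℝ (Fin 2)) => g (toLp 2 ![p.2 0, p.2 1, p.1])) :=
    h1.indicator (measurable_snd measurableSet_ball)
  have h3 := h2.lintegral_prod_right' (ν := (volume : Measure (EuclideanSpace ℝ (Fin 2))))
  have h4 : (fun t : ℝ => ∫⁻ y in ball (0 : (EuclideanSpace ℝ (Fin 2))) R, g (toLp 2 ![y 0, y 1, t])) = fun t : ℝ =>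
      ∫⁻ y : (EuclideanSpace ℝ (Fin 2)), (Prod.snd ⁻¹' ball (0 : (EuclideanSpace ℝ (Fin 2))) R).indicator (fun p : ℝ × (EuclideanSpace ℝ (Fin 2)) => g (toLp 2 ![p.2 0, p.2 1, p.1])) (t, y) := by
    funext t
    rw [← lintegral_indicator measurableSet_ball]
    refine lintegral_congr fun y => ?_
    by_cases hy : y ∈ ball (0 : (EuclideanSpace ℝ (Fin 2))) R
    · rw [indicator_of_mem hy, indicator_of_mem (show (t, y) ∈ Prod.snd ⁻¹' ball (0 : (EuclideanSpace ℝ (Fin 2))) R from hy)]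
    · rw [indicator_of_notMem hy, indicator_of_notMem (show (t, y) ∉ Prod.snd ⁻¹' ball (0 : (EuclideanSpace ℝ (Fin 2))) R from hy)]
  rw [h4]
  exact h3

/-- `0 ≤ 1 + log (Y / a)` for `0 ≤ a ≤ Y` (with the convention `log (Y/0) = 0`). [folklore] -/
theorem one_add_log_div_nonneg {a Y : ℝ} (ha0 : 0 ≤ a) (haY : a ≤ Y) : 0 ≤ 1 + Real.log (Y / a) := by
  rcases ha0.eq_or_lt with h0 | hpos
  · rw [← h0, div_zero, Real.log_zero]
    norm_num
  · have h1 : 1 ≤ Y / a := by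
      rw [le_div_iff₀ hpos, one_mul]
      exact haY
    linarith [Real.log_nonneg h1]

end Tools

section Slicing

/-- **Slicing of `∫_A w(x₂) v₂`**: with `A_t = {y : (y₀,y₁,t) ∈ A}`,
`∫_A w(x₂) (v x)₂ dx = ∫_t w(t) ∫_{A_t} (v(y₀,y₁,t))₂ dy dt`. [folklore] -/
theorem setIntegral_w_mul_eq_integral_slices {b : ℝ} {v : (EuclideanSpace ℝ (Fin 3)) → (EuclideanSpace ℝ (Fin 3))} (hv : Continuous v) {w : ℝ → ℝ} (hw : Measurable w)
    (hw1 : ∀ z : ℝ, |w z| ≤ 1) {A : Set (EuclideanSpace ℝ (Fin 3))} (hA : MeasurableSet A)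
    (hAcyl : A ⊆ {x : (EuclideanSpace ℝ (Fin 3)) | cylRadius x < 2 * b ∧ |x 2| < b}) :
    ∫ x in A, w (x 2) * (v x) 2 =
      ∫ t : ℝ, w t * ∫ y in {y : (EuclideanSpace ℝ (Fin 2)) | (toLp 2 ![y 0, y 1, t] : (EuclideanSpace ℝ (Fin 3))) ∈ A}, (v (toLp 2 ![y 0, y 1, t])) 2 := by
  -- integrability of the integrand on `A`
  have hv2 : Continuous fun x : (EuclideanSpace ℝ (Fin 3)) => (v x) 2 := (EuclideanSpace.proj (2 : Fin 3)).continuous.comp hv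
  have hGA : IntegrableOn (fun x : (EuclideanSpace ℝ (Fin 3)) => w (x 2) * (v x) 2) A volume := by
    refine Integrable.bdd_mul (c := 1) (integrableOn_of_subset_solidCyl hv2 hAcyl) ?_ ?_
    · exact (hw.comp (PiLp.continuous_apply 2 (fun _ : Fin 3 => ℝ) 2).measurable).aestronglyMeasurable
    · exact ae_of_all _ fun x => by rw [Real.norm_eq_abs]; exact hw1 _
  have hGi : Integrable (A.indicator fun x : (EuclideanSpace ℝ (Fin 3)) => w (x 2) * (v x) 2) volume := (integrable_indicator_iff hA).2 hGA
  rw [← integral_indicator hA, integral_eq_integral_slices hGi]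
  refine integral_congr_ae (ae_of_all _ fun t => ?_)
  dsimp only
  rw [← integral_const_mul, ← integral_indicator (measurableSet_sliceSet hA t)]
  refine integral_congr_ae (ae_of_all _ fun y => ?_)
  beta_reduce
  have ht2 : (toLp 2 ![y 0, y 1, t] : (EuclideanSpace ℝ (Fin 3))) 2 = t := by simp
  by_cases hy : (toLp 2 ![y 0, y 1, t] : (EuclideanSpace ℝ (Fin 3))) ∈ A
  · rw [indicator_of_mem hy, indicator_of_mem (show y ∈ {y : (EuclideanSpace ℝ (Fin 2)) | (toLp 2 ![y 0, y 1, t] : (EuclideanSpace ℝ (Fin 3))) ∈ A} from hy), ht2]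
  · rw [indicator_of_notMem hy, indicator_of_notMem (show y ∉ {y : (EuclideanSpace ℝ (Fin 2)) | (toLp 2 ![y 0, y 1, t] : (EuclideanSpace ℝ (Fin 3))) ∈ A} from hy)]

/-- **The axial moment sliced**: with `m(t) = ∫_{A_t} |y|² dy`, `m` is integrable, vanishes for `|t| ≥ b`, and
`∫_{(−b,b)} m = ∫_A r²`. [folklore] -/
theorem moment_slices {b : ℝ} {A : Set (EuclideanSpace ℝ (Fin 3))} (hA : MeasurableSet A)
    (hAcyl : A ⊆ {x : (EuclideanSpace ℝ (Fin 3)) | cylRadius x < 2 * b ∧ |x 2| < b}) :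
    Integrable (fun t : ℝ => ∫ y in {y : (EuclideanSpace ℝ (Fin 2)) | (toLp 2 ![y 0, y 1, t] : (EuclideanSpace ℝ (Fin 3))) ∈ A}, ‖y‖ ^ 2) volume ∧
      ∫ t in Ioo (-b) b, (∫ y in {y : (EuclideanSpace ℝ (Fin 2)) | (toLp 2 ![y 0, y 1, t] : (EuclideanSpace ℝ (Fin 3))) ∈ A}, ‖y‖ ^ 2) =
        ∫ x in A, cylRadius x ^ 2 := by
  have hGi : Integrable (A.indicator fun x : (EuclideanSpace ℝ (Fin 3)) => cylRadius x ^ 2) volume :=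
    (integrable_indicator_iff hA).2 (integrableOn_of_subset_solidCyl (continuous_cylRadius.pow 2) hAcyl)
  -- the slice of `1_A r²` is `1_{A_t} |y|²`
  have hsl : ∀ t : ℝ, (fun y : (EuclideanSpace ℝ (Fin 2)) => (A.indicator fun x : (EuclideanSpace ℝ (Fin 3)) => cylRadius x ^ 2) (toLp 2 ![y 0, y 1, t])) =
      {y : (EuclideanSpace ℝ (Fin 2)) | (toLp 2 ![y 0, y 1, t] : (EuclideanSpace ℝ (Fin 3))) ∈ A}.indicator fun y : (EuclideanSpace ℝ (Fin 2)) => ‖y‖ ^ 2 := by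
    intro t
    funext y
    by_cases hy : (toLp 2 ![y 0, y 1, t] : (EuclideanSpace ℝ (Fin 3))) ∈ A
    · rw [indicator_of_mem hy, indicator_of_mem (show y ∈ {y : (EuclideanSpace ℝ (Fin 2)) | (toLp 2 ![y 0, y 1, t] : (EuclideanSpace ℝ (Fin 3))) ∈ A} from hy),
        cylRadius_sliceMap]
    · rw [indicator_of_notMem hy, indicator_of_notMem (show y ∉ {y : (EuclideanSpace ℝ (Fin 2)) | (toLp 2 ![y 0, y 1, t] : (EuclideanSpace ℝ (Fin 3))) ∈ A} from hy)]
  have hm_eq : (fun t : ℝ => ∫ y in {y : (EuclideanSpace ℝ (Fin 2)) | (toLp 2 ![y 0, y 1, t] : (EuclideanSpace ℝ (Fin 3))) ∈ A}, ‖y‖ ^ 2) =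
      fun t : ℝ => ∫ y : (EuclideanSpace ℝ (Fin 2)), (A.indicator fun x : (EuclideanSpace ℝ (Fin 3)) => cylRadius x ^ 2) (toLp 2 ![y 0, y 1, t]) := by
    funext t
    rw [show (∫ y : (EuclideanSpace ℝ (Fin 2)), (A.indicator fun x : (EuclideanSpace ℝ (Fin 3)) => cylRadius x ^ 2) (toLp 2 ![y 0, y 1, t])) =
      ∫ y : (EuclideanSpace ℝ (Fin 2)), ({y : (EuclideanSpace ℝ (Fin 2)) | (toLp 2 ![y 0, y 1, t] : (EuclideanSpace ℝ (Fin 3))) ∈ A}.indicator fun y : (EuclideanSpace ℝ (Fin 2)) => ‖y‖ ^ 2) y from by rw [hsl t],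
      integral_indicator (measurableSet_sliceSet hA t)]
  have hint : Integrable (fun t : ℝ => ∫ y in {y : (EuclideanSpace ℝ (Fin 2)) | (toLp 2 ![y 0, y 1, t] : (EuclideanSpace ℝ (Fin 3))) ∈ A}, ‖y‖ ^ 2) volume := by
    rw [hm_eq]
    exact (integrable_comp_sliceMap_iff.2 hGi).integral_prod_right
  refine ⟨hint, ?_⟩
  have hA2 : ∀ x ∈ A, |x 2| < b := fun x hx => (hAcyl hx).2
  rw [setIntegral_eq_integral_of_forall_compl_eq_zero fun t ht => ?_]
  · rw [hm_eq, ← integral_eq_integral_slices hGi, integral_indicator hA]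
  · have hbt : b ≤ |t| := by
      by_contra h
      push Not at h
      exact ht ⟨by linarith [neg_abs_le t], by linarith [le_abs_self t]⟩
    rw [sliceSet_eq_empty_of_le hA2 hbt, Measure.restrict_empty, integral_zero_measure]

end Slicing

section PerSlice

/-- **The per-slice estimate in `ℝ≥0∞` currency.** For `S ⊆ B(0,2b)` measurable and `v ∈ C¹`,
`‖∫_S (v(·,t))₂‖ ≤ (4πb²)^{-1/2} |S| ‖v(·,t)‖_{L²(B)} + √C₂ · |S| (1 + log(4πb²/|S|))^{1/2} ‖Dv(·,t)‖_{L²(B)}`,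
from the planar small-set estimate `abs_setIntegral_le_slice` (constant `C₂`). [folklore] -/
theorem enorm_setIntegral_slice_le {C₂ : ℝ} (hC₂ : 0 < C₂)
    (hsl : ∀ R : ℝ, 0 < R → ∀ f : (EuclideanSpace ℝ (Fin 2)) → ℝ, ContDiff ℝ 1 f →
      ∀ A : Set (EuclideanSpace ℝ (Fin 2)), MeasurableSet A → A ⊆ ball (0 : (EuclideanSpace ℝ (Fin 2))) R →
        |∫ x in A, f x| ≤ (volume A).toReal *
          (Real.sqrt (∫ x in ball (0 : (EuclideanSpace ℝ (Fin 2))) R, f x ^ 2) / Real.sqrt (π * R ^ 2) +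
            Real.sqrt (C₂ * (1 + Real.log (π * R ^ 2 / (volume A).toReal)) *
              ∫ x in ball (0 : (EuclideanSpace ℝ (Fin 2))) R, ‖fderiv ℝ f x‖ ^ 2)))
    {b : ℝ} (hb : 0 < b) {v : (EuclideanSpace ℝ (Fin 3)) → (EuclideanSpace ℝ (Fin 3))} (hv : ContDiff ℝ 1 v) (t : ℝ) {S : Set (EuclideanSpace ℝ (Fin 2))} (hS : MeasurableSet S)
    (hSB : S ⊆ ball (0 : (EuclideanSpace ℝ (Fin 2))) (2 * b)) :
    ‖∫ y in S, (v (toLp 2 ![y 0, y 1, t])) 2‖ₑ ≤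
      ENNReal.ofReal ((Real.sqrt (4 * π * b ^ 2))⁻¹) * (volume S *
          (∫⁻ y in ball (0 : (EuclideanSpace ℝ (Fin 2))) (2 * b), ‖v (toLp 2 ![y 0, y 1, t])‖ₑ ^ 2) ^ (1 / 2 : ℝ)) +
        ENNReal.ofReal (Real.sqrt C₂) *
          ((volume S * ENNReal.ofReal (Real.sqrt (1 + Real.log (4 * π * b ^ 2 / (volume S).toReal)))) *
            (∫⁻ y in ball (0 : (EuclideanSpace ℝ (Fin 2))) (2 * b), ‖fderiv ℝ v (toLp 2 ![y 0, y 1, t])‖ₑ ^ 2) ^ (1 / 2 : ℝ)) := by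
  -- the slice function and its regularity
  have hvs : ContDiff ℝ 1 fun y : (EuclideanSpace ℝ (Fin 2)) => v (toLp 2 ![y 0, y 1, t]) := contDiff_comp_sliceMap hv t
  have hf : ContDiff ℝ 1 fun y : (EuclideanSpace ℝ (Fin 2)) => (v (toLp 2 ![y 0, y 1, t])) 2 := by
    rw [show (fun y : (EuclideanSpace ℝ (Fin 2)) => (v (toLp 2 ![y 0, y 1, t])) 2) =
      (EuclideanSpace.proj (2 : Fin 3)) ∘ (fun y : (EuclideanSpace ℝ (Fin 2)) => v (toLp 2 ![y 0, y 1, t])) from rfl]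
    exact (EuclideanSpace.proj (2 : Fin 3)).contDiff.comp hvs
  have h := hsl (2 * b) (by positivity) _ hf S hS hSB
  have h4 : π * (2 * b) ^ 2 = 4 * π * b ^ 2 := by ring
  rw [h4] at h
  -- finiteness and size of `S`
  have hSfin : volume S ≠ ⊤ := ((measure_mono hSB).trans_lt measure_ball_lt_top).ne
  have haS : ENNReal.ofReal (volume S).toReal = volume S := ENNReal.ofReal_toReal hSfin
  have ha0 : 0 ≤ (volume S).toReal := ENNReal.toReal_nonneg
  have haY : (volume S).toReal ≤ 4 * π * b ^ 2 := by
    have h1 : (volume S).toReal ≤ (volume (ball (0 : (EuclideanSpace ℝ (Fin 2))) (2 * b))).toReal :=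
      ENNReal.toReal_mono measure_ball_lt_top.ne (measure_mono hSB)
    rw [volume_ball_fin_two_ofReal (by positivity) (0 : (EuclideanSpace ℝ (Fin 2))), ENNReal.toReal_ofReal (by positivity)] at h1
    linarith
  have hL0 : 0 ≤ 1 + Real.log (4 * π * b ^ 2 / (volume S).toReal) := by
    rcases ha0.eq_or_lt with h0 | hpos
    · rw [← h0, div_zero, Real.log_zero]
      norm_num
    · have h1 : 1 ≤ 4 * π * b ^ 2 / (volume S).toReal := by
        rw [le_div_iff₀ hpos, one_mul]
        exact haY
      linarith [Real.log_nonneg h1]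
  -- the two `L²` quantities dominate the real ones
  have hN0 : 0 ≤ ∫ x in ball (0 : (EuclideanSpace ℝ (Fin 2))) (2 * b), (fun y : (EuclideanSpace ℝ (Fin 2)) => (v (toLp 2 ![y 0, y 1, t])) 2) x ^ 2 :=
    setIntegral_nonneg measurableSet_ball fun x _ => sq_nonneg _
  have hJ0 : 0 ≤ ∫ x in ball (0 : (EuclideanSpace ℝ (Fin 2))) (2 * b), ‖fderiv ℝ (fun y : (EuclideanSpace ℝ (Fin 2)) => (v (toLp 2 ![y 0, y 1, t])) 2) x‖ ^ 2 :=
    setIntegral_nonneg measurableSet_ball fun x _ => sq_nonneg _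
  have hN : ENNReal.ofReal (∫ x in ball (0 : (EuclideanSpace ℝ (Fin 2))) (2 * b), (fun y : (EuclideanSpace ℝ (Fin 2)) => (v (toLp 2 ![y 0, y 1, t])) 2) x ^ 2) ≤
      ∫⁻ y in ball (0 : (EuclideanSpace ℝ (Fin 2))) (2 * b), ‖v (toLp 2 ![y 0, y 1, t])‖ₑ ^ 2 := by
    refine (ofReal_integral_le_lintegral_ofReal_aux fun y => sq_nonneg _).trans
      (lintegral_mono fun y => ?_)
    dsimp only
    rw [← ofReal_norm, ← ENNReal.ofReal_pow (norm_nonneg _)]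
    refine ENNReal.ofReal_le_ofReal ?_
    have h1 : |(v (toLp 2 ![y 0, y 1, t])) 2| ≤ ‖v (toLp 2 ![y 0, y 1, t])‖ := by
      rw [← Real.norm_eq_abs]
      exact PiLp.norm_apply_le (v (toLp 2 ![y 0, y 1, t])) 2
    rw [← sq_abs]
    exact pow_le_pow_left₀ (abs_nonneg _) h1 2
  have hJ : ENNReal.ofReal (∫ x in ball (0 : (EuclideanSpace ℝ (Fin 2))) (2 * b),
      ‖fderiv ℝ (fun y : (EuclideanSpace ℝ (Fin 2)) => (v (toLp 2 ![y 0, y 1, t])) 2) x‖ ^ 2) ≤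
      ∫⁻ y in ball (0 : (EuclideanSpace ℝ (Fin 2))) (2 * b), ‖fderiv ℝ v (toLp 2 ![y 0, y 1, t])‖ₑ ^ 2 := by
    refine (ofReal_integral_le_lintegral_ofReal_aux fun y => sq_nonneg _).trans
      (lintegral_mono fun y => ?_)
    dsimp only
    rw [← ofReal_norm, ← ENNReal.ofReal_pow (norm_nonneg _)]
    refine ENNReal.ofReal_le_ofReal (pow_le_pow_left₀ (norm_nonneg _) ?_ 2)
    exact norm_fderiv_slice_component_le t y (hv.differentiable one_ne_zero _)
  -- conversion of the real estimate
  have hX0 : 0 ≤ Real.sqrt (∫ x in ball (0 : (EuclideanSpace ℝ (Fin 2))) (2 * b), (fun y : (EuclideanSpace ℝ (Fin 2)) => (v (toLp 2 ![y 0, y 1, t])) 2) x ^ 2) /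
      Real.sqrt (4 * π * b ^ 2) := by positivity
  have hY0 : 0 ≤ Real.sqrt (C₂ * (1 + Real.log (4 * π * b ^ 2 / (volume S).toReal)) *
      ∫ x in ball (0 : (EuclideanSpace ℝ (Fin 2))) (2 * b), ‖fderiv ℝ (fun y : (EuclideanSpace ℝ (Fin 2)) => (v (toLp 2 ![y 0, y 1, t])) 2) x‖ ^ 2) :=
    Real.sqrt_nonneg _
  rw [Real.enorm_eq_ofReal_abs]
  refine (ENNReal.ofReal_le_ofReal h).trans ?_
  rw [ENNReal.ofReal_mul ha0, haS, ENNReal.ofReal_add hX0 hY0, mul_add]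
  refine add_le_add ?_ ?_
  · -- the mean term
    rw [div_eq_mul_inv, ENNReal.ofReal_mul (Real.sqrt_nonneg _), ofReal_sqrt_eq_rpow_half hN0]
    calc volume S * (ENNReal.ofReal (∫ x in ball (0 : (EuclideanSpace ℝ (Fin 2))) (2 * b),
            (fun y : (EuclideanSpace ℝ (Fin 2)) => (v (toLp 2 ![y 0, y 1, t])) 2) x ^ 2) ^ (1 / 2 : ℝ) *
          ENNReal.ofReal ((Real.sqrt (4 * π * b ^ 2))⁻¹))
        ≤ volume S * ((∫⁻ y in ball (0 : (EuclideanSpace ℝ (Fin 2))) (2 * b), ‖v (toLp 2 ![y 0, y 1, t])‖ₑ ^ 2) ^ (1 / 2 : ℝ) *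
          ENNReal.ofReal ((Real.sqrt (4 * π * b ^ 2))⁻¹)) := by
          gcongr
      _ = _ := by ring
  · -- the fluctuation term
    rw [Real.sqrt_mul' _ hJ0, Real.sqrt_mul hC₂.le, ENNReal.ofReal_mul (by positivity),
      ENNReal.ofReal_mul (Real.sqrt_nonneg _), ofReal_sqrt_eq_rpow_half hJ0]
    calc volume S * (ENNReal.ofReal (Real.sqrt C₂) *
          ENNReal.ofReal (Real.sqrt (1 + Real.log (4 * π * b ^ 2 / (volume S).toReal))) *
            ENNReal.ofReal (∫ x in ball (0 : (EuclideanSpace ℝ (Fin 2))) (2 * b),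
              ‖fderiv ℝ (fun y : (EuclideanSpace ℝ (Fin 2)) => (v (toLp 2 ![y 0, y 1, t])) 2) x‖ ^ 2) ^ (1 / 2 : ℝ))
        ≤ volume S * (ENNReal.ofReal (Real.sqrt C₂) *
          ENNReal.ofReal (Real.sqrt (1 + Real.log (4 * π * b ^ 2 / (volume S).toReal))) *
            (∫⁻ y in ball (0 : (EuclideanSpace ℝ (Fin 2))) (2 * b), ‖fderiv ℝ v (toLp 2 ![y 0, y 1, t])‖ₑ ^ 2) ^ (1 / 2 : ℝ)) := by
          gcongr
      _ = _ := by ring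

end PerSlice

end Summit.NavierStokesRegularity.NavierStokesRegularity.Theorems.PowerGaugeEulerLiouville.CasimirHaul

end
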